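import Mathlib.Algebra.Algebra.Rat
import Mathlib.Algebra.MonoidAlgebra.Basic
import Mathlib.Algebra.Polynomial.Taylor
import Mathlib.RingTheory.Ideal.Quotient.Nilpotent
import Mathlib.RingTheory.Smooth.Basic
import Mathlib.Data.Nat.Factorial.Basic
import Mathlib.Data.Rat.Lemmas
import Mathlib.Tactic.FieldSimp
import HarnessLib

/-!
# The group algebra `k[ℚ]` over a field of characteristic zero is formally smooth

Topic: `Literature/AlgebraicGeometry/Resolution` (commutative algebra used by the refutation of
the tree's rendering `Temkin2013_Lemma332` of Temkin 2013, Lemma 3.3.2,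
`InseparableLocalUniformizationDecompletionRefutation.lean`). Everything here is elementary and
PROVED; there are no named facts.

`formallySmooth_rat`: for a field `k` of characteristic zero, `k[ℚ] = AddMonoidAlgebra k ℚ` is a
formally smooth `k`-algebra (Mathlib's `Algebra.FormallySmooth`, the discrete infinitesimal
lifting property). It is the directed union of the Laurent polynomial rings `k[t^{±1/n!}]`, each
ÉTALE over the previous one in characteristic zero, so lifts against square-zero thickenings
exist and can be chosen compatibly. Concretely (`Algebra.FormallySmooth.of_comp_surjective`): a
`k`-algebra map `k[ℚ] → B ⧸ I`, `I² = 0`, is a character `χ : ℚ → (B ⧸ I)ˣ`; we lift it to a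
character `ℚ → Bˣ` by constructing a compatible system of roots `c_n ∈ Bˣ`,
`c_n ≡ χ(1/n!) (mod I)`, `c_{n+1}^{n+1} = c_n` (`rootSeq`), each step being one Newton iteration
for `Y^{n+1} = c_n` (`rootLift`, `rootLift_pow`: `(y' - (y'^m - a)/(m y'^{m-1}))^m = a` when
`y'^m ≡ a (mod I)`, `I² = 0`, `m` and `y'` invertible), and then setting
`χ̃(q) = c_N^{q·N!}` for any `N` with `den(q) ∣ N!` (`pw`, independence of `N`: `pw_eq`;
additivity: `pw_add`; the character: `chi`; it lifts `χ`: `mk_chi`).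

## Sources

Standard (group algebras of uniquely divisible groups; Newton/Hensel lifting of simple roots
across square-zero ideals, cf. Iversen, *Generic Local Structure of the Morphisms in Commutative
Algebra*, II.5); no single source — all declarations are `[folklore]`.
-/

noncomputable section

open AddMonoidAlgebra

namespace Literature.AlgebraicGeometry.Resolution

namespace RatGroupAlgebra

/-! ### Lifting roots across a square-zero thickening (one Newton step) -/

section newton

variable {B : Type*} [CommRing B]

/-- One **Newton step** for `Yⁿ = a` starting from `y'`: `y' - (y'ⁿ - a)/(n y'ⁿ⁻¹)` (with
Mathlib's total `Ring.inverse`). [folklore] -/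
def rootLift (n : ℕ) (a y' : B) : B :=
  y' - (y' ^ n - a) * Ring.inverse ((n : B) * y' ^ (n - 1))

/-- The Newton step does not move `y'` modulo any ideal containing `y'ⁿ - a`. [folklore] -/
theorem rootLift_sub_mem {I : Ideal B} (n : ℕ) {a y' : B} (h : y' ^ n - a ∈ I) :
    rootLift n a y' - y' ∈ I := by
  rw [rootLift, sub_sub_cancel_left]
  exact I.neg_mem_iff.mpr (I.mul_mem_right _ h)

/-- **The Newton step solves `Yⁿ = a` exactly across a square-zero ideal**: if `I² = 0`,
`y'ⁿ ≡ a (mod I)` and `n`, `y'` are units, then `(rootLift n a y')ⁿ = a`. [folklore] -/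
theorem rootLift_pow {I : Ideal B} (hI : I ^ 2 = ⊥) {n : ℕ} (hn : IsUnit (n : B)) {a y' : B}
    (hy' : IsUnit y') (h : y' ^ n - a ∈ I) : rootLift n a y' ^ n = a := by
  set δ := (y' ^ n - a) * Ring.inverse ((n : B) * y' ^ (n - 1)) with hδ
  have hδI : δ ∈ I := I.mul_mem_right _ h
  have hδ2 : (-δ) ^ 2 = 0 := by
    rw [neg_sq, ← Ideal.mem_bot, ← hI, sq, sq]
    exact Ideal.mul_mem_mul hδI hδI
  have hunit : IsUnit ((n : B) * y' ^ (n - 1)) := hn.mul (hy'.pow _)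
  have key := Polynomial.eval_add_of_sq_eq_zero (Polynomial.X ^ n) y' (-δ) hδ2
  simp only [Polynomial.eval_pow, Polynomial.eval_X, Polynomial.derivative_X_pow,
    Polynomial.eval_mul, Polynomial.eval_C] at key
  rw [rootLift, sub_eq_add_neg, ← hδ, key, hδ]
  calc y' ^ n + (n : B) * y' ^ (n - 1) * -((y' ^ n - a) * Ring.inverse ((n : B) * y' ^ (n - 1)))
      = y' ^ n - (y' ^ n - a) * (((n : B) * y' ^ (n - 1)) *
          Ring.inverse ((n : B) * y' ^ (n - 1))) := by ring
    _ = a := by rw [Ring.mul_inverse_cancel _ hunit]; ring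

end newton

/-! ### A compatible system of roots lifting a character of `ℚ` -/

section lifting

variable {B : Type*} [CommRing B] (I : Ideal B) (χ : Multiplicative ℚ →* B ⧸ I)

/-- A chosen lift to `B` of `χ(q) ∈ B ⧸ I`. [folklore] -/
def liftOf (q : ℚ) : B :=
  Classical.choose (Ideal.Quotient.mk_surjective (χ (Multiplicative.ofAdd q)))

/-- `liftOf q` lifts `χ(q)`. [folklore] -/
theorem mk_liftOf (q : ℚ) : Ideal.Quotient.mk I (liftOf I χ q) = χ (Multiplicative.ofAdd q) :=
  Classical.choose_spec (Ideal.Quotient.mk_surjective (χ (Multiplicative.ofAdd q)))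

/-- The **compatible system of roots** `c_n ∈ B`: `c_0` lifts `χ(1)`, and `c_{n+1}` is the Newton
correction of a lift of `χ(1/(n+1)!)` for the equation `Y^{n+1} = c_n`. [folklore] -/
def rootSeq : ℕ → B
  | 0 => liftOf I χ 1
  | n + 1 => rootLift (n + 1) (rootSeq n) (liftOf I χ (1 / ((n + 1).factorial : ℚ)))

/-- `(n+1) · 1/(n+1)! = 1/n!`. [folklore] -/
theorem one_div_factorial_succ_smul (n : ℕ) :
    (n + 1) • (1 / ((n + 1).factorial : ℚ)) = 1 / (n.factorial : ℚ) := by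
  rw [Nat.factorial_succ, nsmul_eq_mul]
  push_cast
  field_simp

/-- `c_n ≡ χ(1/n!) (mod I)`. [folklore] -/
theorem mk_rootSeq (n : ℕ) :
    Ideal.Quotient.mk I (rootSeq I χ n) = χ (Multiplicative.ofAdd (1 / (n.factorial : ℚ))) := by
  induction n with
  | zero => simp [rootSeq, mk_liftOf]
  | succ n ih =>
    rw [rootSeq]
    have hmem : liftOf I χ (1 / ((n + 1).factorial : ℚ)) ^ (n + 1) - rootSeq I χ n ∈ I := by
      rw [← Ideal.Quotient.eq, map_pow, mk_liftOf, ih, ← map_pow, ← ofAdd_nsmul,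
        one_div_factorial_succ_smul]
    have := rootLift_sub_mem (I := I) (n + 1) hmem
    rw [← Ideal.Quotient.eq] at this
    rw [this, mk_liftOf]

variable (hI : I ^ 2 = ⊥)
include hI

/-- An element lifting a value of `χ` is a unit (`I` is nilpotent). [folklore] -/
theorem isUnit_of_mk_eq {b : B} {x : Multiplicative ℚ} (h : Ideal.Quotient.mk I b = χ x) :
    IsUnit b := by
  have hnil : IsNilpotent I := ⟨2, hI⟩
  rw [← IsNilpotent.isUnit_quotient_mk_iff hnil, h]
  exact (Group.isUnit x).map χ

/-- Each `c_n` is a unit. [folklore] -/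
theorem isUnit_rootSeq (n : ℕ) : IsUnit (rootSeq I χ n) :=
  isUnit_of_mk_eq I χ hI (mk_rootSeq I χ n)

variable [Algebra ℚ B]

/-- **Compatibility**: `c_{n+1}^{n+1} = c_n` (here `B` is a `ℚ`-algebra, so `n + 1` is a unit).
[folklore] -/
theorem rootSeq_succ_pow (n : ℕ) : rootSeq I χ (n + 1) ^ (n + 1) = rootSeq I χ n := by
  rw [rootSeq]
  refine rootLift_pow hI ?_ (isUnit_of_mk_eq I χ hI (mk_liftOf I χ _)) ?_
  · have : ((n + 1 : ℕ) : B) = algebraMap ℚ B (n + 1 : ℕ) := by simp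
    rw [this]
    exact (IsUnit.mk0 _ (by exact_mod_cast Nat.succ_ne_zero n)).map _
  · rw [← Ideal.Quotient.eq, map_pow, mk_liftOf, mk_rootSeq, ← map_pow, ← ofAdd_nsmul,
      one_div_factorial_succ_smul]

/-- The units `u_n = c_n`. [folklore] -/
def unitSeq (n : ℕ) : Bˣ := (isUnit_rootSeq I χ hI n).unit

omit [Algebra ℚ B] in
/-- `u_n = c_n` in `B`. [folklore] -/
theorem val_unitSeq (n : ℕ) : (unitSeq I χ hI n : B) = rootSeq I χ n := rfl

/-- `u_{n+1}^{n+1} = u_n`. [folklore] -/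
theorem unitSeq_succ_pow (n : ℕ) : unitSeq I χ hI (n + 1) ^ (n + 1) = unitSeq I χ hI n :=
  Units.ext (by simp [val_unitSeq, rootSeq_succ_pow I χ hI n])

/-- `u_n = u_N ^ (N!/n!)` for `n ≤ N`. [folklore] -/
theorem unitSeq_eq_pow {n N : ℕ} (h : n ≤ N) :
    unitSeq I χ hI n = unitSeq I χ hI N ^ (N.factorial / n.factorial) := by
  induction N, h using Nat.le_induction with
  | base => rw [Nat.div_self (Nat.factorial_pos n), pow_one]
  | succ N hnN ih =>
    rw [ih, ← unitSeq_succ_pow I χ hI N, ← pow_mul]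
    congr 1
    rw [Nat.factorial_succ, Nat.mul_div_assoc _ (Nat.factorial_dvd_factorial hnN)]

/-- The exponent `q · N!` as an integer (meaningful when `den q ∣ N!`). [folklore] -/
def zexp (q : ℚ) (N : ℕ) : ℤ := q.num * ((N.factorial / q.den : ℕ) : ℤ)

omit hI [Algebra ℚ B] in
/-- `zexp q N = q · N!` in `ℚ` when `den q ∣ N!`. [folklore] -/
theorem cast_zexp {q : ℚ} {N : ℕ} (h : q.den ∣ N.factorial) :
    (zexp q N : ℚ) = q * N.factorial := by
  rw [zexp, Int.cast_mul, Int.cast_natCast, Nat.cast_div h (by exact_mod_cast q.den_nz)]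
  conv_rhs => rw [← Rat.num_div_den q]
  have : (q.den : ℚ) ≠ 0 := by exact_mod_cast q.den_nz
  field_simp

/-- `pw q N = u_N ^ (q · N!)`, the candidate value `χ̃(q)` computed at level `N`. [folklore] -/
def pw (q : ℚ) (N : ℕ) : Bˣ := unitSeq I χ hI N ^ zexp q N

/-- **Independence of the level**: `pw q n = pw q N` for `den q ∣ n!` and `n ≤ N`. [folklore] -/
theorem pw_eq {q : ℚ} {n N : ℕ} (hn : q.den ∣ n.factorial) (hnN : n ≤ N) :
    pw I χ hI q n = pw I χ hI q N := by
  rw [pw, pw, unitSeq_eq_pow I χ hI hnN, ← zpow_natCast, ← zpow_mul]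
  congr 1
  have hN : q.den ∣ N.factorial := hn.trans (Nat.factorial_dvd_factorial hnN)
  have : ((N.factorial / n.factorial : ℕ) : ℚ) * (zexp q n : ℚ) = (zexp q N : ℚ) := by
    rw [cast_zexp hn, cast_zexp hN, Nat.cast_div (Nat.factorial_dvd_factorial hnN)
      (by exact_mod_cast (Nat.factorial_pos n).ne')]
    field_simp
  have h2 : (((N.factorial / n.factorial : ℕ) * zexp q n : ℤ) : ℚ) = (zexp q N : ℚ) := by
    push_cast; exact this
  exact_mod_cast h2

omit [Algebra ℚ B] in
/-- **Additivity at a fixed level.** [folklore] -/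
theorem pw_add {q r : ℚ} {N : ℕ} (hq : q.den ∣ N.factorial) (hr : r.den ∣ N.factorial)
    (hqr : (q + r).den ∣ N.factorial) :
    pw I χ hI (q + r) N = pw I χ hI q N * pw I χ hI r N := by
  rw [pw, pw, pw, ← zpow_add]
  congr 1
  have : (zexp (q + r) N : ℚ) = zexp q N + zexp r N := by
    rw [cast_zexp hq, cast_zexp hr, cast_zexp hqr, add_mul]
  exact_mod_cast this

/-- The **lifted character** `χ̃ : ℚ → Bˣ`, `χ̃(q) = u_{den q} ^ (q · (den q)!)`. [folklore] -/
def chi : Multiplicative ℚ →* Bˣ where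
  toFun x := pw I χ hI x.toAdd x.toAdd.den
  map_one' := by
    change pw I χ hI 0 (0 : ℚ).den = 1
    rw [pw, zexp, Rat.num_zero, zero_mul, zpow_zero]
  map_mul' x y := by
    set q := x.toAdd
    set r := y.toAdd
    change pw I χ hI (q + r) (q + r).den = pw I χ hI q q.den * pw I χ hI r r.den
    have hqM : q.den ≤ q.den * r.den := Nat.le_mul_of_pos_right _ r.den_pos
    have hrM : r.den ≤ q.den * r.den := Nat.le_mul_of_pos_left _ q.den_pos
    have hqrM : (q + r).den ≤ q.den * r.den :=
      Nat.le_of_dvd (Nat.mul_pos q.den_pos r.den_pos) (Rat.add_den_dvd q r)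
    rw [pw_eq I χ hI (Nat.dvd_factorial (q + r).den_pos le_rfl) hqrM,
      pw_eq I χ hI (Nat.dvd_factorial q.den_pos le_rfl) hqM,
      pw_eq I χ hI (Nat.dvd_factorial r.den_pos le_rfl) hrM]
    exact pw_add I χ hI (Nat.dvd_factorial q.den_pos hqM) (Nat.dvd_factorial r.den_pos hrM)
      (Nat.dvd_factorial (q + r).den_pos hqrM)

/-- Unfolding `χ̃`. [folklore] -/
theorem chi_ofAdd (q : ℚ) : chi I χ hI (Multiplicative.ofAdd q) = pw I χ hI q q.den := rfl

/-- **The lifted character reduces to `χ` modulo `I`.** [folklore] -/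
theorem mk_chi (q : ℚ) :
    Ideal.Quotient.mk I (chi I χ hI (Multiplicative.ofAdd q) : B) = χ (Multiplicative.ofAdd q) := by
  rw [chi_ofAdd, pw]
  set N := q.den
  have hu : Units.map (Ideal.Quotient.mk I : B →* B ⧸ I) (unitSeq I χ hI N) =
      χ.toHomUnits (Multiplicative.ofAdd (1 / (N.factorial : ℚ))) :=
    Units.ext (by simp [val_unitSeq, mk_rootSeq])
  have key : ∀ z : ℤ, Ideal.Quotient.mk I ((unitSeq I χ hI N ^ z : Bˣ) : B) =
      χ (Multiplicative.ofAdd (z • (1 / (N.factorial : ℚ)))) := by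
    intro z
    rw [ofAdd_zsmul, ← MonoidHom.coe_toHomUnits, map_zpow, ← hu, ← map_zpow,
      Units.coe_map]
    rfl
  rw [key]
  congr 2
  rw [zsmul_eq_mul, cast_zexp (Nat.dvd_factorial q.den_pos le_rfl)]
  have : (N.factorial : ℚ) ≠ 0 := by exact_mod_cast (Nat.factorial_pos N).ne'
  field_simp
  rfl

end lifting

/-! ### Formal smoothness of `k[ℚ]` -/

/-- **The group algebra `k[ℚ]` over a field of characteristic zero is formally smooth**: every
`k`-algebra map `k[ℚ] → B ⧸ I` with `I² = 0` is the character of `ℚ` underlying a `k`-algebra map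
`k[ℚ] → B` (`chi`, `mk_chi`). [folklore] -/
theorem formallySmooth_rat (k : Type*) [Field k] [CharZero k] :
    Algebra.FormallySmooth k (AddMonoidAlgebra k ℚ) := by
  refine Algebra.FormallySmooth.of_comp_surjective fun B _ _ I hI g => ?_
  letI : Algebra ℚ B := ((algebraMap k B).comp (algebraMap ℚ k)).toAlgebra
  let χ : Multiplicative ℚ →* B ⧸ I := (lift k (B ⧸ I) ℚ).symm g
  refine ⟨lift k B ℚ ((Units.coeHom B).comp (chi I χ hI)), ?_⟩
  apply (lift k (B ⧸ I) ℚ).symm.injective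
  refine MonoidHom.ext fun x => ?_
  rw [lift_symm_apply, lift_symm_apply, AlgHom.comp_apply, lift_single, one_smul,
    Ideal.Quotient.mkₐ_eq_mk]
  change Ideal.Quotient.mk I (chi I χ hI (Multiplicative.ofAdd x.toAdd) : B) = _
  rw [mk_chi]
  rfl

end RatGroupAlgebra

end Literature.AlgebraicGeometry.Resolution
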